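import Mathlib.RingTheory.MvPowerSeries.Inverse
import Mathlib.RingTheory.Ideal.Quotient.Operations
import Summits.ResolutionOfSingularities.ResolutionOfSingularities.Theorems.EquisingularLiftEquisingularLiftNatSheetTangent
import HarnessLib

/-!
# T-USELESS / T-USEFUL — the model `k[[σ,τ]]/(στ)`: non-vacuity of the hypotheses and both directions instantiated

[OURS · L1 W4.5(b)] Companion of `…Theorems.EquisingularLiftEquisingularLiftNatSheetTangent` (p503986) for the
research stub `stub_elnat_three_nonisolated` of the crux `EquisingularLiftNat` (stmt-ResolutionOfSingularities-20038;
res-L1-w45b-lead-2 LEAD-MEMO-1 §3 bullet 4 / §5 «the two ideal computations of §3 in `k[[σ,τ]]/(στ)`»). NOT a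
statement of any manuscript; AI-written kernel lemmas of the cell `res-hironaka` (weaker than expert review).
Typed by res-type-004.

The abstract lemmas of p503986 are stated over an arbitrary (local) commutative ring with hypotheses `σ * τ = 0`,
`τ ^ (m+1) ≠ 0`, `σ ∉ (τ^m)`. This file certifies that these hypotheses are JOINTLY SATISFIED by the ring the memo
names — the complete local ring of the surface `H = {στ = 0}` at a normal-crossings point of its double curve,
`O = k[[σ,τ]]/(στ) = MvPowerSeries (Fin 2) k ⧸ (X 0 * X 1)` (`σ = X 0`, `τ = X 1`, `k` any field) — so that the
T-USEFUL conclusion is not vacuous there, and records both directions in that ring: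
* `X_one_pow_notMem_span`, `X_zero_notMem_span_sup` — coefficient tests in `k[[σ,τ]]`: `τ^n ∉ (στ)`,
  `σ ∉ (τ^m) + (στ)` for `1 ≤ m` (via `MvPowerSeries.X_dvd_iff` at the monomials `τ^n`, `σ`);
* `model_mul_eq_zero`, `model_pow_ne_zero`, `model_notMem_span_pow`, `model_isLocalRing` — in `O`: `στ = 0`,
  `τ^(m+1) ≠ 0`, `σ ∉ (τ^m)` (`1 ≤ m`), `O` local;
* `model_not_isPrincipal` (T-USEFUL in the model) — `(σ, τ^m) ⊂ k[[σ,τ]]/(στ)` is not principal for `1 ≤ m`;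
* `model_isPrincipal_of_lt` (T-USELESS in the model) — `(σ − τ^r w, τ^m)` is principal for every power series `w`
  with non-zero constant coefficient and `r + 1 ≤ m`;
* `model_isPrincipal_iff` — the dichotomy «principal ↔ `r + 1 ≤ m`» in the model (`1 ≤ m`).

No definitions (the ring and its two generators are spelled out in each statement). References: folklore.
-/

-- single-problem summit: the doubled namespace component `ResolutionOfSingularities` is forced
set_option linter.dupNamespace false

namespace Summit.ResolutionOfSingularities.ResolutionOfSingularities.Cruxes.EquisingularLiftNat.Sections.SheetTangent

open MvPowerSeries

section Model

variable (k : Type*) [Field k]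

/-- In `k[[σ,τ]] = MvPowerSeries (Fin 2) k`: no power `τ^n` lies in the ideal `(στ)` (the coefficient of the
monomial `τ^n` of any multiple of `σ` vanishes). [folklore] -/
theorem X_one_pow_notMem_span (n : ℕ) :
    (X 1 : MvPowerSeries (Fin 2) k) ^ n ∉ Ideal.span {(X 0 : MvPowerSeries (Fin 2) k) * X 1} := by
  classical
  intro h
  obtain ⟨f, hf⟩ := Ideal.mem_span_singleton'.1 h
  have hdvd : (X 0 : MvPowerSeries (Fin 2) k) ∣ X 1 ^ n := ⟨f * X 1, by rw [← hf]; ring⟩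
  have h0 := (X_dvd_iff.1 hdvd) (Finsupp.single 1 n) (by simp)
  rw [coeff_X_pow, if_pos rfl] at h0
  exact one_ne_zero h0

/-- In `k[[σ,τ]]`: for `1 ≤ m`, `σ ∉ (τ^m) + (στ)` (such an element is a multiple of `τ`, and the coefficient of the
monomial `σ` of any multiple of `τ` vanishes). [folklore] -/
theorem X_zero_notMem_span_sup {m : ℕ} (hm : 1 ≤ m) :
    (X 0 : MvPowerSeries (Fin 2) k) ∉
      Ideal.span {(X 1 : MvPowerSeries (Fin 2) k) ^ m} ⊔ Ideal.span {(X 0 : MvPowerSeries (Fin 2) k) * X 1} := by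
  classical
  intro h
  obtain ⟨y, hy, z, hz, hyz⟩ := Submodule.mem_sup.1 h
  obtain ⟨c, rfl⟩ := Ideal.mem_span_singleton'.1 hy
  obtain ⟨f, rfl⟩ := Ideal.mem_span_singleton'.1 hz
  obtain ⟨d, rfl⟩ : ∃ d, m = d + 1 := ⟨m - 1, by omega⟩
  have hdvd : (X 1 : MvPowerSeries (Fin 2) k) ∣ X 0 :=
    ⟨c * X 1 ^ d + f * X 0, by linear_combination (-1 : MvPowerSeries (Fin 2) k) * hyz⟩
  have h0 := (X_dvd_iff.1 hdvd) (Finsupp.single 0 1) (by simp)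
  rw [coeff_X, if_pos rfl] at h0
  exact one_ne_zero h0

/-- In the model `O = k[[σ,τ]]/(στ)`: `σ * τ = 0`. [folklore] -/
theorem model_mul_eq_zero :
    Ideal.Quotient.mk (Ideal.span {(X 0 : MvPowerSeries (Fin 2) k) * X 1}) (X 0) *
      Ideal.Quotient.mk (Ideal.span {(X 0 : MvPowerSeries (Fin 2) k) * X 1}) (X 1) = 0 := by
  rw [← map_mul, Ideal.Quotient.eq_zero_iff_mem]
  exact Ideal.mem_span_singleton_self _

/-- In the model `O = k[[σ,τ]]/(στ)`: `τ ^ n ≠ 0` for every `n`. [folklore] -/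
theorem model_pow_ne_zero (n : ℕ) :
    Ideal.Quotient.mk (Ideal.span {(X 0 : MvPowerSeries (Fin 2) k) * X 1}) (X 1) ^ n ≠ 0 := by
  rw [← map_pow, Ne, Ideal.Quotient.eq_zero_iff_mem]
  exact X_one_pow_notMem_span k n

/-- In the model `O = k[[σ,τ]]/(στ)`: `σ ∉ (τ^m)` for `1 ≤ m`. [folklore] -/
theorem model_notMem_span_pow {m : ℕ} (hm : 1 ≤ m) :
    Ideal.Quotient.mk (Ideal.span {(X 0 : MvPowerSeries (Fin 2) k) * X 1}) (X 0) ∉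
      Ideal.span {Ideal.Quotient.mk (Ideal.span {(X 0 : MvPowerSeries (Fin 2) k) * X 1}) (X 1) ^ m} := by
  intro h
  obtain ⟨c, hc⟩ := Ideal.mem_span_singleton'.1 h
  obtain ⟨c, rfl⟩ := Ideal.Quotient.mk_surjective c
  rw [← map_pow, ← map_mul, Ideal.Quotient.eq] at hc
  apply X_zero_notMem_span_sup k hm
  have h2 : c * X 1 ^ m - (c * X 1 ^ m - X 0) ∈
      Ideal.span {(X 1 : MvPowerSeries (Fin 2) k) ^ m} ⊔ Ideal.span {(X 0 : MvPowerSeries (Fin 2) k) * X 1} :=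
    Submodule.sub_mem _ (Submodule.mem_sup_left (Ideal.mem_span_singleton'.2 ⟨c, rfl⟩))
      (Submodule.mem_sup_right hc)
  rwa [sub_sub_cancel] at h2

/-- The model `O = k[[σ,τ]]/(στ)` is a nontrivial ring (`στ` is not a unit of `k[[σ,τ]]`). [folklore] -/
theorem model_nontrivial :
    Nontrivial (MvPowerSeries (Fin 2) k ⧸ Ideal.span {(X 0 : MvPowerSeries (Fin 2) k) * X 1}) := by
  refine Ideal.Quotient.nontrivial_iff.2 ?_
  rw [Ne, Ideal.span_singleton_eq_top, MvPowerSeries.isUnit_iff_constantCoeff]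
  simp

/-- The model `O = k[[σ,τ]]/(στ)` is a LOCAL ring (quotient of the local ring `k[[σ,τ]]`). [folklore] -/
theorem model_isLocalRing :
    IsLocalRing (MvPowerSeries (Fin 2) k ⧸ Ideal.span {(X 0 : MvPowerSeries (Fin 2) k) * X 1}) := by
  haveI := model_nontrivial k
  exact IsLocalRing.of_surjective' (Ideal.Quotient.mk _) Ideal.Quotient.mk_surjective

/-- **T-USEFUL in the model (non-vacuity certificate for `not_isPrincipal_span_pair`).** In
`O = k[[σ,τ]]/(στ)`, for every `m ≥ 1` the ideal `(σ, τ^m)` — the trace on `H` of the `m`-fold thickening of the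
double curve inside the sheet `{σ = 0}` — is NOT principal. [folklore] -/
theorem model_not_isPrincipal {m : ℕ} (hm : 1 ≤ m) :
    ¬ (Ideal.span {Ideal.Quotient.mk (Ideal.span {(X 0 : MvPowerSeries (Fin 2) k) * X 1}) (X 0),
        Ideal.Quotient.mk (Ideal.span {(X 0 : MvPowerSeries (Fin 2) k) * X 1}) (X 1) ^ m}).IsPrincipal := by
  haveI := model_isLocalRing k
  exact not_isPrincipal_span_pair _ _ (model_mul_eq_zero k) (model_pow_ne_zero k (m + 1))
    (model_notMem_span_pow k hm)

/-- **T-USELESS in the model.** In `O = k[[σ,τ]]/(στ)`, for every power series `w` with non-zero constant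
coefficient (a unit of `k[[σ,τ]]`) and `r + 1 ≤ m`, the trace ideal `(σ − τ^r w, τ^m)` IS principal. [folklore] -/
theorem model_isPrincipal_of_lt (w : MvPowerSeries (Fin 2) k) (hw : constantCoeff w ≠ 0) {r m : ℕ}
    (hm : r + 1 ≤ m) :
    (Ideal.span {Ideal.Quotient.mk (Ideal.span {(X 0 : MvPowerSeries (Fin 2) k) * X 1}) (X 0) -
        Ideal.Quotient.mk (Ideal.span {(X 0 : MvPowerSeries (Fin 2) k) * X 1}) (X 1) ^ r *
          Ideal.Quotient.mk (Ideal.span {(X 0 : MvPowerSeries (Fin 2) k) * X 1}) w,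
        Ideal.Quotient.mk (Ideal.span {(X 0 : MvPowerSeries (Fin 2) k) * X 1}) (X 1) ^ m}).IsPrincipal := by
  have hwu : IsUnit w := MvPowerSeries.isUnit_iff_constantCoeff.2 (isUnit_iff_ne_zero.2 hw)
  exact isPrincipal_span_pair_of_lt _ _ _ (model_mul_eq_zero k) (hwu.map _) hm

/-- **The dichotomy in the model.** In `O = k[[σ,τ]]/(στ)`, `w` with non-zero constant coefficient, `1 ≤ m`:
`(σ − τ^r w, τ^m)` is principal iff `r + 1 ≤ m` — useless iff `ord_τ a < m`, useful iff the structure is `mΣ`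
inside a sheet. [folklore] -/
theorem model_isPrincipal_iff (w : MvPowerSeries (Fin 2) k) (hw : constantCoeff w ≠ 0) {r m : ℕ}
    (hm : 1 ≤ m) :
    (Ideal.span {Ideal.Quotient.mk (Ideal.span {(X 0 : MvPowerSeries (Fin 2) k) * X 1}) (X 0) -
        Ideal.Quotient.mk (Ideal.span {(X 0 : MvPowerSeries (Fin 2) k) * X 1}) (X 1) ^ r *
          Ideal.Quotient.mk (Ideal.span {(X 0 : MvPowerSeries (Fin 2) k) * X 1}) w,
        Ideal.Quotient.mk (Ideal.span {(X 0 : MvPowerSeries (Fin 2) k) * X 1}) (X 1) ^ m}).IsPrincipal ↔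
      r + 1 ≤ m := by
  haveI := model_isLocalRing k
  have hwu : IsUnit w := MvPowerSeries.isUnit_iff_constantCoeff.2 (isUnit_iff_ne_zero.2 hw)
  exact isPrincipal_span_pair_iff _ _ _ (model_mul_eq_zero k) (model_pow_ne_zero k (m + 1))
    (model_notMem_span_pow k hm) (hwu.map _)

end Model

end Summit.ResolutionOfSingularities.ResolutionOfSingularities.Cruxes.EquisingularLiftNat.Sections.SheetTangent
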